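import Literature.AnabelianGeometry.EtaleTheta.Discharge.Sec1Thm16iiCoreKummerTransport
import Literature.AnabelianGeometry.EtaleTheta.Thm16SubdagTransport
import Literature.AnabelianGeometry.EtaleTheta.TemperedRigidityValuation
import Literature.AnabelianGeometry.AbsoluteAnabelian.AbsAnabUnitsTransportHolds
import Literature.AnabelianGeometry.AbsoluteAnabelian.GaloisPadicLogTower
import Literature.AnabelianGeometry.AbsoluteAnabelian.MonoAnalyticNonarchModel
import Literature.FieldTheory.Galois.FixingSubgroupAbsoluteGalois
import Literature.NumberTheory.GaloisRepresentations.LocalExistenceLubinTate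
import HarnessLib

/-!
# [EtTh] Thm. 1.6 (ii) for KUMMER CORES: the `hV` binder from abc-iut-L4's PROVED [AbsAnab] Prop. 1.2.1 (vii), modulo the
# cyclotomic-rigidity junction `hΘι` (proof-only; FILE 2 of abc-iut-L2-lead R1194/R1221 «T16II-HV»)

S. Mochizuki, *The étale theta function …*, Publ. RIMS **45** (2009), §1, Thm. 1.6 (ii) p. 24 (printed 250): "`γ` induces an
isomorphism `H¹(G_{K̈α}, (Δ_Θ)α) →̃ H¹(G_{K̈β}, (Δ_Θ)β)` that preserves both the kernel of these surjections [`(K̈^×)^∧ ↠ Ẑ`] and the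
elements `1 ∈ Ẑ`"; proof p. 250: "[SemiAnbd], Theorem 6.12; [AbsAnab], Proposition 1.2.1, (iv), (vi), (vii)"
[cite: MochizukiEtTh2009, Thm 1.6 (ii) p.24]. Layer L2 of the abc-iut cell, seat abc-iut-L2-t1 (gen 12). PROOF-ONLY (no `def`,
no instance, no `Prop` fact) over FILE 1 (`Sec1Thm16iiCoreKummerTransport`), abc-iut-L6-d5's `Thm16Sub.DeltaPreservesUnitsAndOne`
(the `hV` conclusion of `Thm16Sub.thm16ii_of_prop15ii`), this seat's `ValuationHatData.canonical`, abc-iut-L4's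
`Prop121vii.unitsTransport_holds` ([AbsAnab] 1.2.1 (vii): `ψ̄ : K̄₁^× →̃ K̄₂^×` α-equivariant, `PreservesAbsUnits`,
`PreservesUniformizers` — a THEOREM) and its ℚ̄_p-dictionary (`fixingSubgroupEquivAbsoluteGaloisGroup`,
`PadicAlgCl.mem_integer_subfield_iff`, `isIntegral_valuationInteger_of_norm_le_one`, `unifValue`) — BY NAME.

§1 `KummerCore.deltaPreservesUnitsAndOne_of_transport`: for cores `Cα`, `Cβ`, `γ` with Thm. 1.6 (i) `h`, companion `c`, and
`ψ : ℚ̄_p^× →̃ ℚ̄_p^×` `γ`-equivariant on `Π^tp_{Ÿα}` (`hψG`), compatible with the cyclotomes (`hΘι`, the CYCLOTOMIC-RIGIDITY JUNCTION —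
a hypothesis), preserving `‖·‖ = 1` (`hψu`) and uniformisers (`hψϖ`): EVERY `δ : K̈α^× →̃ K̈β^×` with the transport equation of
Thm. 1.6 (ii)(a) satisfies `DeltaPreservesUnitsAndOne δ` for the canonical valuation data. §2 the dictionary (valuation ↔ norm on
subfields of ℚ̄_p; absolute integers ↔ `‖·‖ ≤ 1`; Mathlib-uniformisers ↔ norm-uniformisers; the Galois/field identifications
agree). §3 `KummerCore.exists_psi_of_unitsTransport` — L4's theorem in ℚ̄_p-currency: from the Galois isomorphism `αG` induced by
`γ` (hypothesis `hαG`) a `ψ` with `hψG ∧ hψu ∧ hψϖ`; **`KummerCore.hV_of_unitsTransport`** — the `hV` binder for cores modulo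
`{hΘι}`. HONEST FRAMING: statements about the typed interface; `hΘι`, `hαG` explicit hypotheses; nothing of [EtTh] is asserted;
no side is taken on [IUTchIII] Cor. 3.12; typed ≠ proved.
-/

noncomputable section

namespace Literature.AnabelianGeometry.EtaleTheta

open Literature.AnabelianGeometry.SemiGraphs
open scoped IsMulCommutative

namespace ThetaSetting.KummerCore

variable {p : ℕ} [Fact p.Prime] {Dα Dβ : ThetaSetting p} {γ : Dα.PiTemp ≃ₜ* Dβ.PiTemp}

/-! ### Every invariant unit is a unit of `K̈` -/

/-- **`K̈^× ↠ (ℚ̄_p^×)^{(Π^tp_Ÿ)^Θ}`**: an invariant unit is fixed by `G_K̈ = aug^Θ((Π^tp_Ÿ)^Θ)`, hence is `toInvYdd` of a unit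
of `K̈` (`ℚ̄_p/ℚ_p` Galois). [cite: MochizukiEtTh2009, Prop 1.5 p.23] -/
theorem exists_eq_toInvYdd {D : ThetaSetting p} (C : D.KummerCore) (u : C.invYdd) : ∃ v : (↥D.Kdd)ˣ, C.toInvYdd v = u := by
  have hmem : ((u : (PadicAlgCl p)ˣ) : PadicAlgCl p) ∈ D.Kdd := by
    apply coe_mem_of_forall_fixingSubgroup D.Kdd
    rw [← C.map_augTheta_gtpYdd]
    exact (C.mem_invariants_iff _ _).mp u.2
  exact ⟨Units.mk0 ⟨_, hmem⟩ (fun h0 => (u : (PadicAlgCl p)ˣ).ne_zero (congrArg Subtype.val h0)),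
    Subtype.ext (Units.ext rfl)⟩

/-- The norm of an invariant unit is that of the unit of `K̈` it comes from. [cite: MochizukiEtTh2009, Prop 1.5 p.23] -/
theorem norm_coe_toInvYdd {D : ThetaSetting p} (C : D.KummerCore) (v : (↥D.Kdd)ˣ) :
    ‖(((C.toInvYdd v : C.invYdd) : (PadicAlgCl p)ˣ) : PadicAlgCl p)‖ = ‖((v : ↥D.Kdd) : PadicAlgCl p)‖ := by rw [coe_toInvYdd]

/-! ### The `hV` binder for cores -/

/-- **Thm. 1.6 (ii)(b)(c) — the `hV` binder — for Kummer CORES**, modulo `hΘι` and the three [AbsAnab] 1.2.1 (vii) properties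
of `ψ` (ℚ̄_p-norm currency): every `δ : K̈α^× →̃ K̈β^×` with the transport property of (ii)(a) preserves the kernels `O^×_K̈` and
carries uniformisers to uniformisers modulo units. Proof: `δ = ψ` on `K̈α^×` (FILE 1 `transport_eq_of_eq_kumYdd`), then `hψu`,
`hψϖ`. [cite: MochizukiEtTh2009, Thm 1.6 (ii) p.24] -/
theorem deltaPreservesUnitsAndOne_of_transport (h : Thm16i γ) (c : ThetaCompanion γ)
    (Cα : Dα.KummerCore) (Cβ : Dβ.KummerCore) (ψ : (PadicAlgCl p)ˣ ≃* (PadicAlgCl p)ˣ)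
    (hψG : ∀ y ∈ Dα.GtpYdd, ∀ x : (PadicAlgCl p)ˣ, ψ (Dα.aug y • x) = Dβ.aug (γ y) • ψ x)
    (hΘι : ∀ ζ : cyclotome (PadicAlgCl p)ˣ,
      c.thetaIso (Cα.coeffHom ζ : Dα.GtpTheta) =
        (Cβ.coeffHom (cyclotome.map (ψ : (PadicAlgCl p)ˣ →* (PadicAlgCl p)ˣ) ζ) : Dβ.GtpTheta))
    (hψu : ∀ x : (PadicAlgCl p)ˣ, ‖(x : PadicAlgCl p)‖ = 1 ↔ ‖(ψ x : PadicAlgCl p)‖ = 1)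
    (hψϖ : ∀ ϖ : (↥Dα.Kdd)ˣ, IsUniformizer Dα ϖ → ∃ ϖ' : (↥Dβ.Kdd)ˣ, IsUniformizer Dβ ϖ' ∧
      (ψ (Units.map (algebraMap (↥Dα.Kdd) (PadicAlgCl p) : ↥Dα.Kdd →* PadicAlgCl p) ϖ) : PadicAlgCl p) =
        ((ϖ' : ↥Dβ.Kdd) : PadicAlgCl p))
    (δ : Cα.toKummerData.KddHat ≃* Cβ.toKummerData.KddHat)
    (hδ : ∀ a, transport c h (Dα.inflTheta Dα.GtpYdd (Cα.toKummerData.kumYdd a)) =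
      Dβ.inflTheta Dβ.GtpYdd (Cβ.toKummerData.kumYdd (δ a))) :
    Thm16Sub.DeltaPreservesUnitsAndOne δ (ValuationHatData.canonical Cα.toKummerData)
      (ValuationHatData.canonical Cβ.toKummerData) := by
  -- `δ = ψ` on `K̈α^×`
  have hδψ : ∀ a : Cα.invYdd, (Subtype.val (δ a) : (PadicAlgCl p)ˣ) = ψ a :=
    transport_eq_of_eq_kumYdd h c Cα Cβ ψ hψG hΘι δ hδ
  refine ⟨?_, ?_⟩
  · -- (b) the kernels `O^×_K̈ ⊆ K̈^×` correspond
    ext b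
    rw [ValuationHatData.canonical_unitsHat, ValuationHatData.canonical_unitsHat]
    constructor
    · rintro ⟨a, ⟨u, hu, rfl⟩, rfl⟩
      obtain ⟨v, hv⟩ := exists_eq_toInvYdd Cβ (δ (Cα.toInvYdd u))
      refine ⟨v, ?_, hv⟩
      change ‖((v : ↥Dβ.Kdd) : PadicAlgCl p)‖ = 1
      rw [← norm_coe_toInvYdd Cβ v, hv, hδψ, ← hψu, coe_toInvYdd]
      exact hu
    · rintro ⟨v, hv, rfl⟩
      obtain ⟨u, hu⟩ := exists_eq_toInvYdd Cα (δ.symm (Cβ.toInvYdd v))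
      refine ⟨Cα.toInvYdd u, ⟨u, ?_, rfl⟩, by rw [hu]; exact δ.apply_symm_apply _⟩
      change ‖((u : ↥Dα.Kdd) : PadicAlgCl p)‖ = 1
      rw [← norm_coe_toInvYdd Cα u, hψu, ← hδψ, hu, MulEquiv.apply_symm_apply, coe_toInvYdd]
      exact hv
  · -- (c) uniformisers to uniformisers modulo units
    intro ϖ hϖ
    obtain ⟨ϖ', hϖ', hψϖ'⟩ := hψϖ ϖ hϖ
    refine ⟨ϖ', hϖ', ?_⟩
    have hδϖ : δ (Cα.toKummerData.toKddHat ϖ) = Cβ.toKummerData.toKddHat ϖ' := by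
      change δ (Cα.toInvYdd ϖ) = Cβ.toInvYdd ϖ'
      apply Subtype.ext
      rw [hδψ]
      apply Units.ext
      rw [coe_toInvYdd, ← hψϖ']
      rfl
    rw [hδϖ, mul_inv_cancel]
    exact one_mem _

end ThetaSetting.KummerCore

/-! ## §2. The ℚ̄_p-currency dictionary for abc-iut-L4's `Prop121vii.unitsTransport_holds` -/

section Dictionary

open Literature.NumberTheory.GaloisRepresentations Literature.AnabelianGeometry.AbsoluteAnabelian
open Literature.FieldTheory.Galois ValuativeRel
open scoped ValuativeRel

variable {p : ℕ} [Fact p.Prime]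

/-- **Valuation vs norm on `E ⊆ ℚ̄_p`**: for the valuative relation of the restricted absolute value
(`PadicAlgCl.subfieldValuativeRel`), `v(x) ≤ v(y) ↔ ‖x‖ ≤ ‖y‖`. [cite: MochizukiAbsTopIII2015, Def 3.1 (i) p.66] -/
theorem subfield_valuation_le_iff (E : IntermediateField ℚ_[p] (PadicAlgCl p)) (x y : E) :
    letI := PadicAlgCl.subfieldValuativeRel E
    valuation E x ≤ valuation E y ↔ ‖(x : PadicAlgCl p)‖ ≤ ‖(y : PadicAlgCl p)‖ := by
  letI := PadicAlgCl.subfieldValuativeRel E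
  haveI : ((Valued.v (R := PadicAlgCl p)).comap (algebraMap E (PadicAlgCl p))).Compatible :=
    Valuation.Compatible.ofValuation _
  rw [← Valuation.vle_iff_le (valuation E),
    Valuation.vle_iff_le ((Valued.v (R := PadicAlgCl p)).comap (algebraMap E (PadicAlgCl p))),
    Valuation.comap_apply, Valuation.comap_apply, PadicAlgCl.valuation_def, PadicAlgCl.valuation_def,
    ← NNReal.coe_le_coe, coe_nnnorm, coe_nnnorm]
  rfl

/-- `v(x) < v(y) ↔ ‖x‖ < ‖y‖` on `E ⊆ ℚ̄_p`. [cite: MochizukiAbsTopIII2015, Def 3.1 (i) p.66] -/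
theorem subfield_valuation_lt_iff (E : IntermediateField ℚ_[p] (PadicAlgCl p)) (x y : E) :
    letI := PadicAlgCl.subfieldValuativeRel E
    valuation E x < valuation E y ↔ ‖(x : PadicAlgCl p)‖ < ‖(y : PadicAlgCl p)‖ := by
  letI := PadicAlgCl.subfieldValuativeRel E
  rw [lt_iff_not_ge, lt_iff_not_ge, subfield_valuation_le_iff]

/-- **Uniformisers: valuation currency ↔ norm currency** (`K̈ ⊆ ℚ̄_p` finite over `ℚ_p`): Mathlib's `Valuation.IsUniformizer`
(`v(ϖ)` = the generator `< 1` of the value group) iff `ThetaSetting.IsUniformizer` (`‖ϖ‖ < 1` maximal).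
[cite: MochizukiEtTh2009, Thm 1.6 (ii) p.24] -/
theorem isUniformizer_iff_valuation_isUniformizer (D : ThetaSetting p) [FiniteDimensional ℚ_[p] D.Kdd]
    (ϖ : (↥D.Kdd)ˣ) :
    letI := PadicAlgCl.subfieldValuativeRel D.Kdd
    haveI := PadicAlgCl.isNonarchimedeanLocalField_subfield D.Kdd
    ThetaSetting.IsUniformizer D ϖ ↔ (valuation ↥D.Kdd).IsUniformizer (ϖ : ↥D.Kdd) := by
  letI := PadicAlgCl.subfieldValuativeRel D.Kdd
  haveI := PadicAlgCl.isNonarchimedeanLocalField_subfield D.Kdd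
  have h1 : ‖((1 : ↥D.Kdd) : PadicAlgCl p)‖ = 1 := by simp
  rw [isUniformizer_iff_valuation_eq_unifValue]
  constructor
  · rintro ⟨hlt, hmax⟩
    have hvlt : valuation (↥D.Kdd) (ϖ : ↥D.Kdd) < 1 := by
      rw [← map_one (valuation ↥D.Kdd), subfield_valuation_lt_iff, h1]
      exact hlt
    refine le_antisymm ((valuation_le_unifValue_iff_lt_one _ _).mpr hvlt) ?_
    obtain ⟨ϖ₀, hϖ₀⟩ := exists_isUniformizer (↥D.Kdd)
    rw [isUniformizer_iff_valuation_eq_unifValue] at hϖ₀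
    have h0lt : ‖((ϖ₀ : ↥D.Kdd) : PadicAlgCl p)‖ < 1 := by
      rw [← h1, ← subfield_valuation_lt_iff, map_one, hϖ₀]
      exact unifValue_lt_one _
    rw [← hϖ₀, subfield_valuation_le_iff]
    exact hmax _ h0lt
  · intro hϖ
    have hvlt : valuation (↥D.Kdd) (ϖ : ↥D.Kdd) < 1 := by rw [hϖ]; exact unifValue_lt_one _
    refine ⟨?_, fun x hx => ?_⟩
    · rw [← h1, ← subfield_valuation_lt_iff, map_one]
      exact hvlt
    · have hxv : valuation (↥D.Kdd) x < 1 := by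
        rw [← map_one (valuation ↥D.Kdd), subfield_valuation_lt_iff, h1]
        exact hx
      rw [← subfield_valuation_le_iff, hϖ]
      exact (valuation_le_unifValue_iff_lt_one _ _).mpr hxv

/-- **Absolute integers ↔ `‖·‖ ≤ 1`**: for `E ⊆ ℚ̄_p` finite over `ℚ_p` and `e := algEquivAlgebraicClosure E : ℚ̄_p ≃ₐ[E] Ē`,
`e z` is integral over `𝒪_E` iff `‖z‖ ≤ 1`. [cite: MochizukiAbsAnab2004, Prop 1.2.1 (iii) p.10] -/
theorem mem_absIntegers_algEquiv_iff (E : IntermediateField ℚ_[p] (PadicAlgCl p)) [FiniteDimensional ℚ_[p] E]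
    (z : PadicAlgCl p) :
    letI := PadicAlgCl.subfieldValuativeRel E
    algEquivAlgebraicClosure E z ∈ absIntegers 𝒪[↥E] ↥E ↔ ‖z‖ ≤ 1 := by
  letI := PadicAlgCl.subfieldValuativeRel E
  have hO : ∀ c : ↥E, c ∈ 𝒪[↥E] ↔ ‖algebraMap (↥E) (PadicAlgCl p) c‖ ≤ 1 := PadicAlgCl.mem_integer_subfield_iff E
  -- the two `𝒪_E`-algebra structure maps agree through `e`
  have hcomp : (algebraMap 𝒪[↥E] (PadicAlgCl p)).comp (RingHom.id 𝒪[↥E]) =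
      ((algEquivAlgebraicClosure E).symm : AlgebraicClosure ↥E →+* PadicAlgCl p).comp
        (algebraMap 𝒪[↥E] (AlgebraicClosure ↥E)) := by
    ext c
    rw [RingHom.comp_apply, RingHom.comp_apply, RingHom.id_apply,
      IsScalarTower.algebraMap_apply 𝒪[↥E] (↥E) (AlgebraicClosure ↥E),
      IsScalarTower.algebraMap_apply 𝒪[↥E] (↥E) (PadicAlgCl p)]
    exact ((algEquivAlgebraicClosure E).symm.commutes _).symm
  have hcomp' : (algebraMap 𝒪[↥E] (AlgebraicClosure ↥E)).comp (RingHom.id 𝒪[↥E]) =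
      ((algEquivAlgebraicClosure E) : PadicAlgCl p →+* AlgebraicClosure ↥E).comp (algebraMap 𝒪[↥E] (PadicAlgCl p)) := by
    ext c
    rw [RingHom.comp_apply, RingHom.comp_apply, RingHom.id_apply,
      IsScalarTower.algebraMap_apply 𝒪[↥E] (↥E) (AlgebraicClosure ↥E),
      IsScalarTower.algebraMap_apply 𝒪[↥E] (↥E) (PadicAlgCl p)]
    exact ((algEquivAlgebraicClosure E).commutes _).symm
  rw [mem_integralClosure_iff]
  constructor
  · intro h
    have h' := IsIntegral.map_of_comp_eq (RingHom.id 𝒪[↥E])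
      ((algEquivAlgebraicClosure E).symm : AlgebraicClosure ↥E →+* PadicAlgCl p) hcomp h
    rw [RingHom.coe_coe, AlgEquiv.symm_apply_apply] at h'
    exact norm_le_one_of_isIntegral_valuationInteger p (fun c hc => (hO c).mp hc) h'
  · exact fun h => IsIntegral.map_of_comp_eq (RingHom.id 𝒪[↥E])
      ((algEquivAlgebraicClosure E) : PadicAlgCl p →+* AlgebraicClosure ↥E) hcomp'
      (isIntegral_valuationInteger_of_norm_le_one p (fun c hc => (hO c).mpr hc) h)

/-- Units: `e z ∈ 𝒪_{K̄}^×` (both `e z` and `(e z)⁻¹` integral) iff `‖z‖ = 1`. [cite: MochizukiAbsAnab2004, Prop 1.2.1 (iii) p.10] -/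
theorem mem_absIntegers_units_algEquiv_iff (E : IntermediateField ℚ_[p] (PadicAlgCl p)) [FiniteDimensional ℚ_[p] E]
    (z : (PadicAlgCl p)ˣ) :
    letI := PadicAlgCl.subfieldValuativeRel E
    (((Units.mapEquiv (algEquivAlgebraicClosure E).toMulEquiv z : (AlgebraicClosure ↥E)ˣ) : AlgebraicClosure ↥E) ∈
        absIntegers 𝒪[↥E] ↥E ∧
      (↑(Units.mapEquiv (algEquivAlgebraicClosure E).toMulEquiv z)⁻¹ : AlgebraicClosure ↥E) ∈
        absIntegers 𝒪[↥E] ↥E) ↔ ‖(z : PadicAlgCl p)‖ = 1 := by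
  letI := PadicAlgCl.subfieldValuativeRel E
  have h1 : ((Units.mapEquiv (algEquivAlgebraicClosure E).toMulEquiv z : (AlgebraicClosure ↥E)ˣ) :
      AlgebraicClosure ↥E) = algEquivAlgebraicClosure E (z : PadicAlgCl p) := Units.coe_mapEquiv _ _
  have h2 : (↑(Units.mapEquiv (algEquivAlgebraicClosure E).toMulEquiv z)⁻¹ : AlgebraicClosure ↥E) =
      algEquivAlgebraicClosure E ((z⁻¹ : (PadicAlgCl p)ˣ) : PadicAlgCl p) := by
    rw [← map_inv]; exact Units.coe_mapEquiv _ _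
  rw [h1, h2, mem_absIntegers_algEquiv_iff, mem_absIntegers_algEquiv_iff, Units.val_inv_eq_inv_val, norm_inv]
  constructor
  · rintro ⟨hle, hinv⟩
    have hpos : 0 < ‖(z : PadicAlgCl p)‖ := norm_pos_iff.mpr z.ne_zero
    exact le_antisymm hle (by rwa [inv_le_one₀ hpos] at hinv)
  · exact fun h => by rw [h, inv_one]; exact ⟨le_rfl, le_rfl⟩

/-- **The Galois identification and the field identification agree**: for `σ ∈ Gal(ℚ̄_p/E) ≤ G_{ℚ_p}` and `z ∈ ℚ̄_p`,
`e(σ z) = ẽ(σ)(e z)` where `e := algEquivAlgebraicClosure E : ℚ̄_p ≃ₐ[E] AlgebraicClosure E` and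
`ẽ := fixingSubgroupEquivAbsoluteGaloisGroup E` (its defining formula `fixingSubgroupMulEquiv_apply`).
[cite: NeukirchANT1999, Ch. IV §1] -/
theorem algEquivAlgebraicClosure_smul (E : IntermediateField ℚ_[p] (PadicAlgCl p))
    (σ : ↥E.fixingSubgroup) (z : PadicAlgCl p) :
    algEquivAlgebraicClosure E ((σ : GQp p) • z) =
      Field.absoluteGaloisGroup.toAlgEquiv (↥E) (fixingSubgroupEquivAbsoluteGaloisGroup E σ)
        (algEquivAlgebraicClosure E z) := by
  change algEquivAlgebraicClosure E ((σ : GQp p) z) =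
    (fixingSubgroupMulEquiv E (algEquivAlgebraicClosure E) σ) (algEquivAlgebraicClosure E z)
  rw [fixingSubgroupMulEquiv_apply, AlgEquiv.symm_apply_apply]

/-- The inverse direction: `e⁻¹(ẽ(τ) w) = τ (e⁻¹ w)` for `τ ∈ Gal(ℚ̄_p/E)`. [cite: NeukirchANT1999, Ch. IV §1] -/
theorem algEquivAlgebraicClosure_symm_toAlgEquiv (E : IntermediateField ℚ_[p] (PadicAlgCl p))
    (τ : ↥E.fixingSubgroup) (w : AlgebraicClosure ↥E) :
    (algEquivAlgebraicClosure E).symm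
        (Field.absoluteGaloisGroup.toAlgEquiv (↥E) (fixingSubgroupEquivAbsoluteGaloisGroup E τ) w) =
      (τ : GQp p) • (algEquivAlgebraicClosure E).symm w := by
  change (algEquivAlgebraicClosure E).symm ((fixingSubgroupMulEquiv E (algEquivAlgebraicClosure E) τ) w) =
    (τ : GQp p) ((algEquivAlgebraicClosure E).symm w)
  rw [fixingSubgroupMulEquiv_apply, AlgEquiv.symm_apply_apply]

/-- **`α`-equivariance at the level of values** (generic fields, where the Galois action on `K̄^×` is the transported
`Units.mulDistribMulActionRight`): if `y = σ·x` on underlying elements then `ψ̄ y = α(σ)·ψ̄ x` on underlying elements.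
[cite: MochizukiAbsAnab2004, Prop 1.2.1 (vi) p.10] -/
theorem isAlphaEquivariant_val {K₁ K₂ : Type} [Field K₁] [Field K₂]
    {α : Field.absoluteGaloisGroup K₁ ≃ₜ* Field.absoluteGaloisGroup K₂}
    {ψ : (AlgebraicClosure K₁)ˣ ≃* (AlgebraicClosure K₂)ˣ} (hψ : Prop121vii.IsAlphaEquivariant α ψ)
    (σ : Field.absoluteGaloisGroup K₁) (x y : (AlgebraicClosure K₁)ˣ)
    (hy : (y : AlgebraicClosure K₁) = Field.absoluteGaloisGroup.toAlgEquiv K₁ σ (x : AlgebraicClosure K₁)) :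
    (ψ y : AlgebraicClosure K₂) =
      Field.absoluteGaloisGroup.toAlgEquiv K₂ (α σ) (ψ x : AlgebraicClosure K₂) := by
  have hyx : y = σ • x := Units.ext (by rw [hy, Units.coe_smul, Field.absoluteGaloisGroup.smul_def])
  rw [hyx, hψ, Units.coe_smul, Field.absoluteGaloisGroup.smul_def]

end Dictionary

/-! ## §3. The three properties of `ψ` from abc-iut-L4's theorem, and `hV` for cores modulo `hΘι` -/

namespace ThetaSetting.KummerCore

open Literature.NumberTheory.GaloisRepresentations Literature.AnabelianGeometry.AbsoluteAnabelian
open Literature.AnabelianGeometry.AbsoluteAnabelian.Prop121vii Literature.FieldTheory.Galois Field ValuativeRel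
open scoped ValuativeRel

variable {p : ℕ} [Fact p.Prime] {Dα Dβ : ThetaSetting p} {γ : Dα.PiTemp ≃ₜ* Dβ.PiTemp}

/-- `aug(Π^tp_Ÿ) ⊆ G_K̈` for a setting carrying a Kummer core (`map_augTheta_gtpYdd`).
[cite: MochizukiEtTh2009, Prop 1.5 p.23] -/
theorem aug_mem_fixingSubgroup {D : ThetaSetting p} (C : D.KummerCore) {y : D.PiTemp} (hy : y ∈ D.GtpYdd) :
    D.aug y ∈ D.Kdd.fixingSubgroup := by
  rw [← C.map_augTheta_gtpYdd, ← C.augTheta_toTheta]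
  exact ⟨D.toTheta y, ⟨y, hy, rfl⟩, rfl⟩

/-- **[AbsAnab] Prop. 1.2.1 (vii) at a pair of theta settings with Kummer cores, in ℚ̄_p-currency** (abc-iut-L4's PROVED
`Prop121vii.unitsTransport_holds` moved along `fixingSubgroupEquivAbsoluteGaloisGroup` / `algEquivAlgebraicClosure`): from an
isomorphism `αG : G_{K̈α} →̃ G_{K̈β}` inside `G_{ℚ_p}` induced by `γ` on `Π^tp_{Ÿα}` (`hαG`), a `ψ : ℚ̄_p^× →̃ ℚ̄_p^×` that is
`γ`-equivariant, preserves `‖·‖ = 1` and carries norm-uniformisers to norm-uniformisers. [cite: MochizukiAbsAnab2004, Prop 1.2.1 (vii) p.11] -/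
theorem exists_psi_of_unitsTransport (Cα : Dα.KummerCore) (Cβ : Dβ.KummerCore)
    (αG : ↥Dα.Kdd.fixingSubgroup ≃ₜ* ↥Dβ.Kdd.fixingSubgroup)
    (hαG : ∀ (y : Dα.PiTemp) (hy : y ∈ Dα.GtpYdd),
      ((αG ⟨Dα.aug y, aug_mem_fixingSubgroup Cα hy⟩ : ↥Dβ.Kdd.fixingSubgroup) : GQp p) = Dβ.aug (γ y)) :
    ∃ ψ : (PadicAlgCl p)ˣ ≃* (PadicAlgCl p)ˣ,
      (∀ y ∈ Dα.GtpYdd, ∀ x : (PadicAlgCl p)ˣ, ψ (Dα.aug y • x) = Dβ.aug (γ y) • ψ x) ∧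
      (∀ x : (PadicAlgCl p)ˣ, ‖(x : PadicAlgCl p)‖ = 1 ↔ ‖(ψ x : PadicAlgCl p)‖ = 1) ∧
      (∀ ϖ : (↥Dα.Kdd)ˣ, IsUniformizer Dα ϖ → ∃ ϖ' : (↥Dβ.Kdd)ˣ, IsUniformizer Dβ ϖ' ∧
        (ψ (Units.map (algebraMap (↥Dα.Kdd) (PadicAlgCl p) : ↥Dα.Kdd →* PadicAlgCl p) ϖ) : PadicAlgCl p) =
          ((ϖ' : ↥Dβ.Kdd) : PadicAlgCl p)) := by
  haveI : FiniteDimensional ℚ_[p] Dα.Kdd := Cα.finiteDimensional_Kdd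
  haveI : FiniteDimensional ℚ_[p] Dβ.Kdd := Cβ.finiteDimensional_Kdd
  letI := PadicAlgCl.subfieldValuativeRel Dα.Kdd
  letI := PadicAlgCl.subfieldValuativeRel Dβ.Kdd
  haveI := PadicAlgCl.isNonarchimedeanLocalField_subfield Dα.Kdd
  haveI := PadicAlgCl.isNonarchimedeanLocalField_subfield Dβ.Kdd
  -- the Galois isomorphism on Mathlib's absolute Galois groups, and abc-iut-L4's theorem
  obtain ⟨ψ₀, hψ₀α, hψ₀u, hψ₀ϖ⟩ := unitsTransport_holds (↥Dα.Kdd) (↥Dβ.Kdd)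
    (((fixingSubgroupEquivAbsoluteGaloisGroup Dα.Kdd).symm.trans αG).trans
      (fixingSubgroupEquivAbsoluteGaloisGroup Dβ.Kdd))
  -- `ψ := e_β⁻¹ ∘ ψ̄ ∘ e_α` on units of ℚ̄_p
  refine ⟨((Units.mapEquiv (algEquivAlgebraicClosure Dα.Kdd).toMulEquiv).trans ψ₀).trans
    (Units.mapEquiv (algEquivAlgebraicClosure Dβ.Kdd).symm.toMulEquiv), fun y hy x => ?_, fun x => ?_, fun ϖ hϖ => ?_⟩
  · -- γ-equivariance, on underlying elements of ℚ̄_p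
    have hσ := aug_mem_fixingSubgroup Cα hy
    apply Units.ext
    have hx : ((Units.mapEquiv (algEquivAlgebraicClosure Dα.Kdd).toMulEquiv
          ((((⟨Dα.aug y, hσ⟩ : ↥Dα.Kdd.fixingSubgroup) : GQp p) • x)) : (AlgebraicClosure ↥Dα.Kdd)ˣ) :
          AlgebraicClosure ↥Dα.Kdd) =
        Field.absoluteGaloisGroup.toAlgEquiv (↥Dα.Kdd) (fixingSubgroupEquivAbsoluteGaloisGroup Dα.Kdd ⟨Dα.aug y, hσ⟩)
          ((Units.mapEquiv (algEquivAlgebraicClosure Dα.Kdd).toMulEquiv x : (AlgebraicClosure ↥Dα.Kdd)ˣ) :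
            AlgebraicClosure ↥Dα.Kdd) := by
      rw [Units.coe_mapEquiv, Units.coe_mapEquiv]
      exact algEquivAlgebraicClosure_smul Dα.Kdd _ _
    rw [MulEquiv.trans_apply, MulEquiv.trans_apply, MulEquiv.trans_apply, MulEquiv.trans_apply,
      Units.coe_mapEquiv]
    change (algEquivAlgebraicClosure Dβ.Kdd).symm
        ((ψ₀ (Units.mapEquiv (algEquivAlgebraicClosure Dα.Kdd).toMulEquiv
          ((((⟨Dα.aug y, hσ⟩ : ↥Dα.Kdd.fixingSubgroup) : GQp p) • x))) : (AlgebraicClosure ↥Dβ.Kdd)ˣ) :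
          AlgebraicClosure ↥Dβ.Kdd) =
      Dβ.aug (γ y) • (algEquivAlgebraicClosure Dβ.Kdd).symm
        ((ψ₀ (Units.mapEquiv (algEquivAlgebraicClosure Dα.Kdd).toMulEquiv x) : (AlgebraicClosure ↥Dβ.Kdd)ˣ) :
          AlgebraicClosure ↥Dβ.Kdd)
    rw [isAlphaEquivariant_val hψ₀α (fixingSubgroupEquivAbsoluteGaloisGroup Dα.Kdd ⟨Dα.aug y, hσ⟩)
      (Units.mapEquiv (algEquivAlgebraicClosure Dα.Kdd).toMulEquiv x) _ hx,
      ContinuousMulEquiv.trans_apply, ContinuousMulEquiv.trans_apply, ContinuousMulEquiv.symm_apply_apply,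
      algEquivAlgebraicClosure_symm_toAlgEquiv, hαG y hy]
  · -- units
    rw [← mem_absIntegers_units_algEquiv_iff Dα.Kdd x, hψ₀u,
      ← mem_absIntegers_units_algEquiv_iff Dβ.Kdd, MulEquiv.trans_apply, MulEquiv.trans_apply]
    have hx : ∀ X : (AlgebraicClosure ↥Dβ.Kdd)ˣ, Units.mapEquiv (algEquivAlgebraicClosure Dβ.Kdd).toMulEquiv
        (Units.mapEquiv (algEquivAlgebraicClosure Dβ.Kdd).symm.toMulEquiv X) = X := fun X => by
      apply Units.ext
      rw [Units.coe_mapEquiv, Units.coe_mapEquiv]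
      exact (algEquivAlgebraicClosure Dβ.Kdd).apply_symm_apply _
    rw [hx]
  · -- uniformisers
    have hϖv : (valuation ↥Dα.Kdd).IsUniformizer ((ϖ : ↥Dα.Kdd)) :=
      (isUniformizer_iff_valuation_isUniformizer Dα ϖ).mp hϖ
    obtain ⟨ϖ', hϖ', hψϖ⟩ := hψ₀ϖ ϖ hϖv
    refine ⟨ϖ', (isUniformizer_iff_valuation_isUniformizer Dβ ϖ').mpr hϖ', ?_⟩
    have hmap : Units.mapEquiv (algEquivAlgebraicClosure Dα.Kdd).toMulEquiv
        (Units.map (algebraMap (↥Dα.Kdd) (PadicAlgCl p) : ↥Dα.Kdd →* PadicAlgCl p) ϖ) =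
        Units.map (algebraMap (↥Dα.Kdd) (AlgebraicClosure ↥Dα.Kdd) : ↥Dα.Kdd →* AlgebraicClosure ↥Dα.Kdd) ϖ := by
      apply Units.ext
      rw [Units.coe_mapEquiv, Units.coe_map, Units.coe_map, MonoidHom.coe_coe, MonoidHom.coe_coe]
      exact (algEquivAlgebraicClosure Dα.Kdd).commutes _
    rw [MulEquiv.trans_apply, MulEquiv.trans_apply, Units.coe_mapEquiv, hmap, hψϖ, Units.coe_map, MonoidHom.coe_coe]
    exact (algEquivAlgebraicClosure Dβ.Kdd).symm.commutes _

/-- **Thm. 1.6 (ii) `hV` for Kummer CORES via abc-iut-L4's [AbsAnab] Prop. 1.2.1 (vii)** (∃ψ-form): from `αG` (`hαG`) a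
`γ`-equivariant, `‖·‖ = 1`-preserving `ψ : ℚ̄_p^× →̃ ℚ̄_p^×` such that WHENEVER the companion `c` satisfies the CYCLOTOMIC-RIGIDITY
JUNCTION `hΘι` for `ψ` ([SemiAnbd] Thm. 6.12 on `Δ_Θ` — the one remaining named hypothesis), every `δ : K̈α^× →̃ K̈β^×` with the
transport property of (ii)(a) satisfies `Thm16Sub.DeltaPreservesUnitsAndOne δ` (canonical valuation data) — the `hV` binder of
`Thm16Sub.thm16ii_of_prop15ii`. [cite: MochizukiEtTh2009, Thm 1.6 (ii) p.24] -/
theorem hV_of_unitsTransport (h : Thm16i γ) (c : ThetaCompanion γ) (Cα : Dα.KummerCore) (Cβ : Dβ.KummerCore)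
    (αG : ↥Dα.Kdd.fixingSubgroup ≃ₜ* ↥Dβ.Kdd.fixingSubgroup)
    (hαG : ∀ (y : Dα.PiTemp) (hy : y ∈ Dα.GtpYdd),
      ((αG ⟨Dα.aug y, aug_mem_fixingSubgroup Cα hy⟩ : ↥Dβ.Kdd.fixingSubgroup) : GQp p) = Dβ.aug (γ y)) :
    ∃ ψ : (PadicAlgCl p)ˣ ≃* (PadicAlgCl p)ˣ,
      (∀ y ∈ Dα.GtpYdd, ∀ x : (PadicAlgCl p)ˣ, ψ (Dα.aug y • x) = Dβ.aug (γ y) • ψ x) ∧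
      (∀ x : (PadicAlgCl p)ˣ, ‖(x : PadicAlgCl p)‖ = 1 ↔ ‖(ψ x : PadicAlgCl p)‖ = 1) ∧
      ((∀ ζ : cyclotome (PadicAlgCl p)ˣ,
          c.thetaIso (Cα.coeffHom ζ : Dα.GtpTheta) =
            (Cβ.coeffHom (cyclotome.map (ψ : (PadicAlgCl p)ˣ →* (PadicAlgCl p)ˣ) ζ) : Dβ.GtpTheta)) →
        ∀ δ : Cα.toKummerData.KddHat ≃* Cβ.toKummerData.KddHat,
          (∀ a, transport c h (Dα.inflTheta Dα.GtpYdd (Cα.toKummerData.kumYdd a)) =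
            Dβ.inflTheta Dβ.GtpYdd (Cβ.toKummerData.kumYdd (δ a))) →
          Thm16Sub.DeltaPreservesUnitsAndOne δ (ValuationHatData.canonical Cα.toKummerData)
            (ValuationHatData.canonical Cβ.toKummerData)) := by
  obtain ⟨ψ, hψG, hψu, hψϖ⟩ := exists_psi_of_unitsTransport (γ := γ) Cα Cβ αG hαG
  exact ⟨ψ, hψG, hψu, fun hΘι δ hδ =>
    deltaPreservesUnitsAndOne_of_transport h c Cα Cβ ψ hψG hΘι hψu hψϖ δ hδ⟩

end ThetaSetting.KummerCore

end Literature.AnabelianGeometry.EtaleTheta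

end
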